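import Summits.HubbardSuperconductivity.HubbardSuperconductivity.Theorems.AnisotropyChordTransferFibre3FinX3Eval

/-!
# Route `AnisotropyChord` / H0 rotor rung: FIN per-`L` GM₃ (X5), `L = 28` — rows `N₁` / D / side-condition cell facts, part `p58`

Kernel facts (`decide +kernel`) for cert cells 135, 136 of the per-`L` grid of `L = 28`: `xbnCellAny2` (row `N₁` on XB2 point wedges recomputed in the kernel, exporting the literal brackets `nt ⊇ T⁺ − 3λ₂` and `tb ⊇ T⁺·D`), `xdCellAnyN0` (row D, reads `nt`), `sdCellAnyZN` (side condition, reads `nt`); evaluators `…FinX3Eval` / `…FinX5Eval`; constants from the compiled design probe (x3probe/x3plan, margins c ×0.985, b ×1.03, aD ×1.03); assembled in `…FinX5GM3TwentyEight`.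
Prover seat `hubbard-h0-rotor-p3` g8; helper for piece A = stmt-HubbardSuperconductivity-23918 of rung 19089 (`--supports`, helper class).
WHAT THIS IS NOT: nothing here proves superconductivity in the Hubbard model (rotor TARGET as worded stays FALSE, g15 verdict); kernel facts for the FIN certificate of ONE conditional reduction.  Tree imports only; zero data; standard axioms.
-/

set_option linter.dupNamespace false
set_option autoImplicit false

namespace Summit.HubbardSuperconductivity.HubbardSuperconductivity.Theorems.AnisotropyChord.Transfer.Fibre3

namespace FinXD

open FinXB FinCell Hole2

set_option maxHeartbeats 4000000 in
/-- row `N₁` of cell 135 of `L = 28` (`c = 14/25`), exporting `nt`, `tb`. [folklore] -/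
theorem xn28_135 : xbnCellAny2 28 (49/50 : ℚ) 1909866296072937 1957612953474761 (14/25 : ℚ) ((46876447753337 : ℤ), (70941050294449 : ℤ)) ((5776440365275809 : ℤ), (5943814881415071 : ℤ)) = true := by decide +kernel

set_option maxHeartbeats 4000000 in
/-- row D of cell 135 of `L = 28` (`aD = 19/250`). [folklore] -/
theorem xd28_135 : xdCellAnyN0 28 (49/50 : ℚ) 1909866296072937 1957612953474761 (19/250 : ℚ) ((46876447753337 : ℤ), (70941050294449 : ℤ)) = true := by decide +kernel

set_option maxHeartbeats 4000000 in
/-- side condition of cell 135 of `L = 28` (`c, b = 130/100, aD`). [folklore] -/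
theorem sd28_135 : sdCellAnyZN 28 (49/50 : ℚ) 100 1909866296072937 1957612953474761 ((14/25 : ℚ), (130 : ℕ), (19/250 : ℚ)) ((46876447753337 : ℤ), (70941050294449 : ℤ)) = true := by decide +kernel

set_option maxHeartbeats 4000000 in
/-- row `N₁` of cell 136 of `L = 28` (`c = 14/25`), exporting `nt`, `tb`. [folklore] -/
theorem xn28_136 : xbnCellAny2 28 (49/50 : ℚ) 1957612953474761 2006553277311630 (14/25 : ℚ) ((50090027624159 : ℤ), (75984276415749 : ℤ)) ((5922893043084694 : ℤ), (6095679953314387 : ℤ)) = true := by decide +kernel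

set_option maxHeartbeats 4000000 in
/-- row D of cell 136 of `L = 28` (`aD = 19/250`). [folklore] -/
theorem xd28_136 : xdCellAnyN0 28 (49/50 : ℚ) 1957612953474761 2006553277311630 (19/250 : ℚ) ((50090027624159 : ℤ), (75984276415749 : ℤ)) = true := by decide +kernel

set_option maxHeartbeats 4000000 in
/-- side condition of cell 136 of `L = 28` (`c, b = 133/100, aD`). [folklore] -/
theorem sd28_136 : sdCellAnyZN 28 (49/50 : ℚ) 100 1957612953474761 2006553277311630 ((14/25 : ℚ), (133 : ℕ), (19/250 : ℚ)) ((50090027624159 : ℤ), (75984276415749 : ℤ)) = true := by decide +kernel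

end FinXD

end Summit.HubbardSuperconductivity.HubbardSuperconductivity.Theorems.AnisotropyChord.Transfer.Fibre3
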